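import Summits.BirchSwinnertonDyer.BirchSwinnertonDyer.Theorems.ByReductionTypeAtTwoSupersingularColemanRoad
import Summits.BirchSwinnertonDyer.Rank1Residual.X5.TwoAdicTargets
import Literature.NumberTheory.EllipticCurves.KatoFineSelmerDualTorsion
import Literature.NumberTheory.EllipticCurves.Sprung2012.SharpFlatSelmerModuleFiniteProofs
import Literature.NumberTheory.EllipticCurves.Sprung2012.SharpFlatSelmerDualExistsProofs
import Literature.NumberTheory.EllipticCurves.Sprung2017.SharpFlatPAdicLFunctionTwoProofs
import Summits.BirchSwinnertonDyer.Rank1Residual.Supersingular.BlindInterpolationFlatTwoUnit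
import Summits.BirchSwinnertonDyer.Rank1Residual.Supersingular.FrobeniusTraceTwoParity
import HarnessLib

/-!
# Route `ByReductionTypeAtTwo` (rung K4), crux `SupersingularRankZeroAtTwo` (item
# stmt-BirchSwinnertonDyer-19097): THE ♭ COLEMAN ROAD AT `p = 2` — the Kato half `MissingUpperBoundAt W 2`
# on the WHOLE good-supersingular sub-class (`a₂ ∈ {0, ±2}`, in particular the `a₂ = ±2` sub-row tagged
# MATH-BOUND since GEN 0) from Kato's Thm. 12.4 and ONE ♭ Coleman / Poitou–Tate / Euler-system package plus
# ONE ♭ `Γ`-Euler characteristic READ AT `2` on Sprung's REAL objects `X^♭(E/ℚ_∞)`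
# (`Sprung2012.SharpFlatSelmerDualData`, typed 2026-08-26 for K3) — seat `bsd-2adic-ss-1`, GEN 9

HONEST FRAMING (cell `bsd-2adic`, run/shared/lean/pub/bsd-2adic/, HUMAN RULINGS D-0036/D-0054/D-0074):
THEOREMS ONLY; every research input an explicit hypothesis on SUPPLIED data; no definition, no named
fact, no instance, no `sorry`; nothing booked; BSD is NOT proved by any of this. PARTITION (D-0054): X5@2
good-supersingular, `a₂ = ±2` sub-row (B1·O1; 549 rank-`0` classes = 483 with `a₂ = 2` + 66 with
`a₂ = −2`) × `p = 2` — types-the-object-of; closes none.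

## What this file does, and what it does NOT do

The `±` Coleman road of GEN 7/8 (`…SupersingularColemanRoad{,V5,V6}.lean`, kit p490756, 208 class
instances) reaches `BSD(E,2)` on `a₂ = 0` from Kobayashi's REAL `X⁺(E/ℚ_∞)`; on `a₂ = ±2` Kobayashi's `±`
objects are VACUOUS (p431399) and the line kept the two Miller halves as its stub (MATH-BOUND). Since
2026-08-26 the tree holds Sprung's ♯/♭ vocabulary (cell `bsd-ssimc`, K3): `Sprung2012.IsColemanPair`, the
kernels `Ker Col^•`, `Sel^•(E/K_∞)` and its dual hypothesis structure `Sprung2012.SharpFlatSelmerDualData W κ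
γ ι a_p g c •` (f.g. over `Λ` for EVERY datum: `SharpFlatSelmerDualData.moduleFinite`; inhabited:
`nonempty_sharpFlatSelmerDualData`); Sprung's pair at `2` EXISTS (`exists_isSprungPair_two`) with
`L♭(0) = (−a₂² + 2a₂ + 1)·[0]⁺_f` (`constantCoeff_flat_two_of_isSprungPair_of_isNewformOf`), `c♭ = 1, 1, −7`
for `a₂ = 0, 2, −2`: a `2`-ADIC UNIT. This file transposes the `±` road to `♭` symbol for symbol:

* §1 (any `p`, any colour `•`, ANY local data `(ι, a_p, g, c)`): the Coleman skeleton on `X^•` —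
  `sharpFlatSelmerDual_isTorsion_of_colemanSkeleton` (Sprung Thm. 7.14's torsion clause FROM the
  package), `exists_charGenerator_mul_eq_of_colemanSkeleton'` (Thm. 7.16 with `n = 0` FROM the package),
  `exists_pow_mul_mem_charIdeal_of_colemanSkeletonRat'` (Thm. 7.16 first clause: `pⁿ·G ∈ char X^•`, NO
  image hypothesis) — pure module theory (`Kato2004.thm17_4_skeleton`,
  `Kato2004.mem_charIdeal_of_skeleton_integral`, PROVED in the tree over any domain).
* §2 (`p = 2`, colour `♭`, `E = W` good supersingular at `2`, local Coleman data SUPPLIED as arguments):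
  `flatUpper_two_of_flatColemanKato` — `X^♭` is `Λ`-torsion and `char X^♭ = (g)`, `ι(g·h) = ϖ·ι L♭`
  for every Sprung pair at `2` and every dual datum, from `Kato2004.thm12_4`, `Kato2004_fineSelmerDual_isTorsion`,
  the `2`-adic image certificate `TwoAdicSurjective W` and the ♭ package (below); `…_of_mu` — the same on
  a curve WITHOUT the image certificate from the package's rational part plus `μ(X^♭) = 0`. The KATO
  HALF `ord₂ #Ш ≤ ord₂ #Ш_an` and the certificate-fed doors are the sequel `…SupersingularFlatRoadDoor.lean`.

LOCAL DATA ARE SUPPLIED, NOT ASSERTED. Sprung builds `Col` from a Honda system `(c_n)` of local points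
(Thm. 2.2; at `p = 2` "`F_ss(𝔪_{−2}) = F_ss(𝔪_{−1})` by `c_{−2}`", p. 1487, with the bottom relation
`Tr_{k_0/ℚ₂} c_0 = a₂·c_{−1} − c_{−2}` DERIVED from its construction — the printed (2′) is a misprint); the tree's predicate
`Sprung2012.IsHondaSystem` is the ODD-`p` `ℤ_p`-tower form (its docstring: "TODO(general form): `p = 2`").
This file therefore asserts NO Honda predicate at `2`: every theorem is universally quantified over the
local data `(ι, g, c)` through which `X^♭` is DEFINED, and the research inputs are hypotheses ABOUT
THAT DATA. Their use requires ONE datum for which they hold — in print: Sprung's Honda system at `2`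
(Thm. 2.2 (2′), PRINT at `p = 2`) with his Coleman maps at `2` (§§2–6, "we included the prime `p = 2`",
p. 1486; `N = n + 2`, `Δ = {±1}`), READ on the `ℤ₂`-tower `ℚ_∞` (the `Δ`-descent, as for `±`).

## The ♭ package, field by field (what a D-audit reads; `[cite]` = the odd-`p` print; `@2` = READ AT 2)

For `W` good supersingular at `2` (any `a₂ ∈ {0, ±2}`), cyclotomic `(κ, γ)` matching the cyclotomic
variable, local data `(ι, g, c)`, the newform `f`, the period ratio `ϖ` (`ϖ·Ω_W = Ω⁺_f`), a Sprung pair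
`(L♯, L♭)` at `2` (EXISTS: `exists_isSprungPair_two`; UNIQUE: `IsSprungPair.unique`) and a dual datum `D`
of `Sel^♭(E/ℚ_∞)` cut out by `Ker Col^♭` of the data: there are `I : IwasawaH1Data W 2 κ γ` (`𝐇¹`, torsion
free of rank `1`: Kato Thm. 12.4 (2), PRINT any `p`), `Y : FineSelmerDualData` (`X⁰`, torsion: Kato
12.4 (1) ∘ (17.13.1), `Kato2004_fineSelmerDual_isTorsion`), `P ≤ Λ` (the image of `Col^♭`; `= Λ` in print,
Sprung Prop. 7.3), `loc : 𝐇¹ → P` (`Col^♭ ∘ loc_𝔭`), `toX : P → X^♭`, `δ : X^♭ → X⁰`, `Z ≤ 𝐇¹` (Kato's zeta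
submodule), `G ∈ loc(Z)` with: **F1♭** `Exact loc toX ∧ Exact toX δ` [Sprung Prop. 7.19 = Kobayashi
Thm. 7.3 i) with `Sel^±` replaced by `Sel^♭`, exact sequence (3) p. 1504; @2 incl. the `Δ = {±1}` descent
of `Col^♭` from `k_∞ = ℚ₂(μ_{2^∞})` to `ℚ_∞`]; **F3♭** `ι G = ϖ·ι L♭` [Sprung Def. 6.1 / Prop. 6.3–6.5:
`Col(z_Kato) = (L♯_p, L♭_p)` — §§2–6 INCLUDE `p = 2`; Néron normalisation via `ϖ`; `z ∈ 𝐇¹(T)`: `E[2]`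
irreducible at a good supersingular `2`, and the `2`-integrality of `z` on the `Γ`-tower = audit-1 ssCK
ADDENDUM-2 F3c, P-READ]; **F4rat** `length_𝔭 X⁰ ≤ length_𝔭 𝐇¹/Z` at height-one `𝔭 ∌ 2` [Kato Thm. 12.5
(3), no image hypothesis, no parity]; **F4@(2)** the same at `𝔭 ∋ 2` UNDER `TwoAdicSurjective W` [Kato
Thm. 12.5 (4) "assume `p ≠ 2`", at `2` Kurihara–Otsuki p. 564 P-ASSERT; residue [KK4] 0.8 / [Ru3] 2.3.3].
(The ♭ `Γ`-Euler characteristic EC♭ — Sprung 2024 §5.2 L5.5·5.8·5.9 READ AT `2` — enters only the sequel.)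

References: [Sprung2012] Thm. 2.2, §§2–6, Def. 6.1, Prop. 6.3–6.5, Def. 7.9/7.11, Thm. 7.14, 7.16,
Prop. 7.19 (pp. 1486–1505); [Sprung2017] Thm. 1.12, Cor. 4.4, Cor. 4.11 (row `p = 2`); [Sprung2024]
§5.2 Lemmas 5.5–5.9 (pp. 40–41); [Kato2004Asterisque] Thm. 12.4, 12.5, §17.13; [Kobayashi2003] Thm. 7.3;
[KuriharaOtsuki2006] p. 564; [Miller2011LMS] Def. 1.1.
-/

set_option autoImplicit false
-- the Theorems namespace of this sub repeats the summit name by design (D-0017 nested layout)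
set_option linter.dupNamespace false

noncomputable section

open scoped Classical MatrixGroups ModularForm

open CongruenceSubgroup WeierstrassCurve Literature.NumberTheory.EllipticCurves
  Literature.NumberTheory.EllipticCurves.ModularForms Literature.NumberTheory.EllipticCurves.Sprung2017
  Literature.NumberTheory.EllipticCurves.Sprung2012
  Literature.NumberTheory.EllipticCurves.Rank1Residual Literature.NumberTheory.EllipticCurves.Rank1Residual.Typed
  Literature.NumberTheory.EllipticCurves.IwasawaDual Literature.NumberTheory.GaloisRepresentations
  ZpExtension Summit.BirchSwinnertonDyer.Rank1Residual Summit.BirchSwinnertonDyer.Rank1Residual.Supersingular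
  Summit.BirchSwinnertonDyer.Rank1Residual.X5.O1

universe u

namespace Summit.BirchSwinnertonDyer.BirchSwinnertonDyer.Theorems

namespace SSFlatRoad

/-! ## §1 The Coleman skeleton on `X^•(E/K_∞)` at any prime and colour (Sprung §7 as module theory) -/

section AnyPrime

variable {p : ℕ} [Fact p.Prime] {W : WeierstrassCurve ℚ} [W.IsElliptic]
  [ContinuousSMul ℤ_[p] (W.tateModule p)]
  {κ : ZpExtension ℚ p} {γ : Field.absoluteGaloisGroup ℚ}
  {E : Type} [Field E] [Algebra ℚ E] {ι : AlgebraicClosure ℚ →ₐ[ℚ] AlgebraicClosure E}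
  {ap : ℤ} {g : Field.absoluteGaloisGroup E} {c : ℕ → localPoints W E} {col : Chroma}
  {P : Type*} [AddCommGroup P] [Module (IwasawaAlgebra p) P]

/-- **Sprung Thm. 7.14 (torsion clause) FROM the Coleman skeleton, any `p`, any colour, any local
data.** On the pinned `𝐇¹ = I.H` (torsion free of rank `≤ 1`), `X⁰ = Y.X` (torsion) and `X^• = D.X`: if
`𝐇¹ →loc P →toX X^• →δ X⁰` is exact at `P` and at `X^•`, `col : P ↪ Λ` is injective and some `G ≠ 0` lies
in `col(loc Z)`, then `X^•(E/ℚ_∞)` is `Λ`-torsion. Pure module theory (`Kato2004.thm17_4_skeleton`).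
[cite: Sprung2012, Thm. 7.14 and its proof (p. 1504)] [cite: Kato2004Asterisque, Thm. 17.4 (1) and §17.13 (p. 280)] -/
theorem sharpFlatSelmerDual_isTorsion_of_colemanSkeleton
    (I : Kato2004.IwasawaH1Data W p κ γ) [Module.IsTorsionFree (IwasawaAlgebra p) I.H]
    (hrank : Module.rank (IwasawaAlgebra p) I.H ≤ 1)
    (Y : W.FineSelmerDualData κ γ) (D : SharpFlatSelmerDualData W κ γ ι ap g c col)
    (loc : I.H →ₗ[IwasawaAlgebra p] P) (cl : P →ₗ[IwasawaAlgebra p] IwasawaAlgebra p)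
    (hcl : Function.Injective cl)
    (toX : P →ₗ[IwasawaAlgebra p] D.X) (δ : D.X →ₗ[IwasawaAlgebra p] Y.X)
    (hPX : Function.Exact loc toX) (hXY : Function.Exact toX δ)
    (hY : Module.IsTorsion (IwasawaAlgebra p) Y.X)
    (Z : Submodule (IwasawaAlgebra p) I.H) {G : IwasawaAlgebra p} (hG : G ≠ 0)
    (hGZ : G ∈ Submodule.map (cl ∘ₗ loc) Z) :
    Module.IsTorsion (IwasawaAlgebra p) D.X :=
  (Kato2004.thm17_4_skeleton hrank loc toX δ hPX hXY cl hcl hY Z hG hGZ).1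

/-- **Sprung Thm. 7.16 with `n = 0`, FROM the Coleman skeleton (any `p`, any colour, any local data).**
In the situation of `sharpFlatSelmerDual_isTorsion_of_colemanSkeleton`, if moreover the Euler-system
bound `length_𝔭 X⁰ ≤ length_𝔭 (𝐇¹/Z)` holds at EVERY height-one prime `𝔭`, then for a characteristic
power series `g` of `X^•` (`char X^• = (g)`; `Λ` is a UFD) one has `g · h = G` for some `h ∈ Λ`. For
`G = 0` take `h = 0`; otherwise `Kato2004.mem_charIdeal_of_skeleton_integral` (finite generation of `X^•`
being the tree theorem `SharpFlatSelmerDualData.moduleFinite`).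
[cite: Sprung2012, Thm. 7.16 (p. 1504) and Prop. 7.19 (p. 1505)]
[cite: Kato2004Asterisque, Thm. 12.5 (4) (p. 222) and Thm. 17.4 (3) (p. 273)] -/
theorem exists_charGenerator_mul_eq_of_colemanSkeleton' (hγ : κ.IsTopGenerator γ)
    (I : Kato2004.IwasawaH1Data W p κ γ) [Module.IsTorsionFree (IwasawaAlgebra p) I.H]
    (hrank : Module.rank (IwasawaAlgebra p) I.H ≤ 1)
    (Y : W.FineSelmerDualData κ γ) (D : SharpFlatSelmerDualData W κ γ ι ap g c col)
    (loc : I.H →ₗ[IwasawaAlgebra p] P) (cl : P →ₗ[IwasawaAlgebra p] IwasawaAlgebra p)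
    (hcl : Function.Injective cl)
    (toX : P →ₗ[IwasawaAlgebra p] D.X) (δ : D.X →ₗ[IwasawaAlgebra p] Y.X)
    (hPX : Function.Exact loc toX) (hXY : Function.Exact toX δ)
    (hY : Module.IsTorsion (IwasawaAlgebra p) Y.X)
    (Z : Submodule (IwasawaAlgebra p) I.H) {G : IwasawaAlgebra p}
    (hGZ : G ∈ Submodule.map (cl ∘ₗ loc) Z)
    (hES : ∀ 𝔭 : PrimeSpectrum (IwasawaAlgebra p), 𝔭.asIdeal.height = 1 →
      Literature.NumberTheory.EllipticCurves.Module.lengthAt (IwasawaAlgebra p) Y.X 𝔭 ≤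
        Literature.NumberTheory.EllipticCurves.Module.lengthAt (IwasawaAlgebra p) (I.H ⧸ Z) 𝔭) :
    ∃ g' h : IwasawaAlgebra p, D.charIdeal = Ideal.span {g'} ∧ g' * h = G := by
  obtain ⟨g', hg⟩ := (charIdeal_isPrincipal_holds p D.X).principal
  have hg' : D.charIdeal = Ideal.span {g'} := hg
  by_cases hG : G = 0
  · exact ⟨g', 0, hg', by rw [mul_zero, hG]⟩
  · haveI : Module.Finite (IwasawaAlgebra p) D.X := D.moduleFinite hγ
    obtain ⟨-, hmem⟩ := Kato2004.mem_charIdeal_of_skeleton_integral p hrank loc toX δ hPX hXY cl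
      hcl hY Z hG hGZ hES
    have hmem' : G ∈ Ideal.span {g'} := by rw [← hg']; exact hmem
    obtain ⟨h, hh⟩ := Ideal.mem_span_singleton'.mp hmem'
    exact ⟨g', h, hg', by rw [mul_comm]; exact hh⟩

/-- **Sprung Thm. 7.16, first clause (`pⁿ L^• ∈ Char X^•`), FROM the RATIONAL Coleman skeleton (any `p`,
any colour, any local data; NO image hypothesis).** As above, but with the Euler-system bound only at the
height-one primes `𝔭 ∌ p` (Kato Thm. 12.5 (3)): `X^•` is torsion and `p^m · G ∈ char X^•` for some `m`.
[cite: Sprung2012, Thm. 7.16 first clause (p. 1504)]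
[cite: Kato2004Asterisque, Thm. 12.5 (3) (p. 222) and Thm. 17.4 (2) (p. 273)] -/
theorem exists_pow_mul_mem_charIdeal_of_colemanSkeletonRat' (hγ : κ.IsTopGenerator γ)
    (I : Kato2004.IwasawaH1Data W p κ γ) [Module.IsTorsionFree (IwasawaAlgebra p) I.H]
    (hrank : Module.rank (IwasawaAlgebra p) I.H ≤ 1)
    (Y : W.FineSelmerDualData κ γ) (D : SharpFlatSelmerDualData W κ γ ι ap g c col)
    (loc : I.H →ₗ[IwasawaAlgebra p] P) (cl : P →ₗ[IwasawaAlgebra p] IwasawaAlgebra p)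
    (hcl : Function.Injective cl)
    (toX : P →ₗ[IwasawaAlgebra p] D.X) (δ : D.X →ₗ[IwasawaAlgebra p] Y.X)
    (hPX : Function.Exact loc toX) (hXY : Function.Exact toX δ)
    (hY : Module.IsTorsion (IwasawaAlgebra p) Y.X)
    (Z : Submodule (IwasawaAlgebra p) I.H) {G : IwasawaAlgebra p} (hG : G ≠ 0)
    (hGZ : G ∈ Submodule.map (cl ∘ₗ loc) Z)
    (hES : ∀ 𝔭 : PrimeSpectrum (IwasawaAlgebra p), 𝔭.asIdeal.height = 1 →
      PowerSeries.C (p : ℤ_[p]) ∉ 𝔭.asIdeal →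
      Literature.NumberTheory.EllipticCurves.Module.lengthAt (IwasawaAlgebra p) Y.X 𝔭 ≤
        Literature.NumberTheory.EllipticCurves.Module.lengthAt (IwasawaAlgebra p) (I.H ⧸ Z) 𝔭) :
    Module.IsTorsion (IwasawaAlgebra p) D.X ∧
      ∃ m : ℕ, PowerSeries.C (p : ℤ_[p]) ^ m * G ∈ D.charIdeal := by
  haveI : Module.Finite (IwasawaAlgebra p) D.X := D.moduleFinite hγ
  obtain ⟨htors, hlen⟩ := Kato2004.thm17_4_skeleton hrank loc toX δ hPX hXY cl hcl hY Z hG hGZ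
  exact ⟨htors, Literature.NumberTheory.EllipticCurves.Module.exists_pow_mul_mem_charIdeal_of_lengthAt_le
    htors (IwasawaAlgebra.prime_C p) hG fun 𝔭 h1 hp𝔭 ↦ hlen 𝔭 (hES 𝔭 h1 hp𝔭)⟩

end AnyPrime

/-! ## §2 `p = 2`, colour `♭`: the upper divisibility, the Kato half and the doors -/

section AtTwo

variable (W : WeierstrassCurve ℚ) [W.IsElliptic] [W.IsGloballyMinimal]
  {κ : ZpExtension ℚ 2} {γ : Field.absoluteGaloisGroup ℚ}
  {E : Type} [Field E] [Algebra ℚ E] (ι : AlgebraicClosure ℚ →ₐ[ℚ] AlgebraicClosure E)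
  (g : Field.absoluteGaloisGroup E) (c : ℕ → localPoints W E)

/-- The `♭` member of a Sprung pair at `2` does NOT vanish in analytic rank `0` (any `a₂ ∈ {0, ±2}`):
`L♭(0) = (−a₂² + 2a₂ + 1)·[0]⁺_f` with `−a₂² + 2a₂ + 1 ∈ {1, −7}` and `[0]⁺_f ≠ 0 ⟸ L(E,1) ≠ 0`.
[cite: Sprung2017, Thm. 1.12, Cor. 4.4 and Cor. 4.11 (row `p = 2`)] -/
theorem flat_ne_zero_two {N : ℕ} [NeZero N] {f : CuspForm (Gamma0 N) 2} (hf : IsNewformOf W f)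
    (hgood : W.HasGoodReductionAtPrime 2) (hss : (2 : ℤ) ∣ W.frobeniusTrace 2)
    (hL : W.entireLFunction 1 ≠ 0) {Ls Lf : IwasawaAlgebra 2}
    (hSP : IsSprungPair f 2 (W.frobeniusTrace 2) Ls Lf) : Lf ≠ 0 := by
  intro h0
  have hc := constantCoeff_flat_two_of_isSprungPair_of_isNewformOf hf hgood hSP
  rw [h0, map_zero, PadicInt.coe_zero] at hc
  -- `a₂ ∈ {0, ±2}` at a good supersingular `2`
  have hs0 : ratPlusSymbol f 0 ≠ 0 := by
    intro h0'
    apply hL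
    rw [hf.entireLFunction_one_eq, h0']
    simp
  have hcne : (-(W.frobeniusTrace 2 : ℚ) ^ 2 + 2 * (W.frobeniusTrace 2) + 1) ≠ 0 := by
    rcases frobeniusTrace_two_eq_zero_or W hgood hss with h | h | h <;> · rw [h]; norm_num
  have : (((-(W.frobeniusTrace 2 : ℚ) ^ 2 + 2 * (W.frobeniusTrace 2) + 1) * ratPlusSymbol f 0 : ℚ) :
      ℚ_[2]) = 0 := hc.symm
  exact mul_ne_zero hcne hs0 (by exact_mod_cast this)

/-- **The ♭ upper divisibility at the curve from Kato's facts, the `2`-adic image certificate and the ♭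
package for SUPPLIED local data** (`p = 2`, colour `♭`, any `a₂ ∈ {0, ±2}`, analytic rank `0`). For the
supplied cyclotomic datum `(κ, γ)` and local Coleman data `(ι, g, c)`: if for every newform `f` of `W`,
period ratio `ϖ`, Sprung pair `(L♯, L♭)` at `2` and dual datum `D` of `Sel^♭(E/ℚ_∞)` the ♭ package holds
(module docstring: F1♭ · F3♭ · F4rat · F4@(2) guarded by `TwoAdicSurjective W`), then for all such
`(f, ϖ, L♯, L♭, D)`: `X^♭` is `Λ`-torsion, `char X^♭ = (g')` and `ι(g'·h) = ϖ·ι L♭`. `𝐇¹_Γ(T₂W)` is torsion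
free of rank `1` by `Kato2004.thm12_4`, `X⁰` is torsion by `Kato2004_fineSelmerDual_isTorsion` (PRINT, any
`p`); `G ≠ 0` because `L♭ ≠ 0` in rank `0` (`flat_ne_zero_two`).
[cite: Sprung2012, Thm. 7.14, Thm. 7.16 and Prop. 7.19 (pp. 1504–1505), Def. 6.1 (p. 1496)]
[cite: Kato2004Asterisque, Thm. 12.4 (p. 221) and Thm. 12.5 (4) (p. 222)] [cite: KuriharaOtsuki2006, p. 564] -/
theorem flatUpper_two_of_flatColemanKato (h124 : Kato2004.thm12_4)
    (hX0 : Kato2004_fineSelmerDual_isTorsion)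
    (hgood : W.HasGoodReductionAtPrime 2) (hss : (2 : ℤ) ∣ W.frobeniusTrace 2)
    (hL : W.entireLFunction 1 ≠ 0)
    (hκ : κ.IsCyclotomic) (hγ : κ.IsTopGenerator γ) (hsurj : TwoAdicSurjective W)
    (hCK : ∀ [NeZero (W.conductorNorm ℤ)] (f : CuspForm (Gamma0 (W.conductorNorm ℤ)) 2),
        IsNewformOf W f → ∀ (ϖ : ℚ), (ϖ : ℝ) * W.realPeriodRat = plusPeriod f →
      ∀ (Ls Lf : IwasawaAlgebra 2), IsSprungPair f 2 (W.frobeniusTrace 2) Ls Lf →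
      ∀ (D : SharpFlatSelmerDualData W κ γ ι (W.frobeniusTrace 2) g c .flat)
        [ContinuousSMul ℤ_[2] (W.tateModule 2)],
        ∃ (I : Kato2004.IwasawaH1Data W 2 κ γ) (Y : W.FineSelmerDualData κ γ)
          (P : Submodule (IwasawaAlgebra 2) (IwasawaAlgebra 2))
          (loc : I.H →ₗ[IwasawaAlgebra 2] P) (toX : P →ₗ[IwasawaAlgebra 2] D.X)
          (δ : D.X →ₗ[IwasawaAlgebra 2] Y.X) (Z : Submodule (IwasawaAlgebra 2) I.H)
          (G : IwasawaAlgebra 2),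
          Function.Exact loc toX ∧ Function.Exact toX δ ∧
          G ∈ Submodule.map (P.subtype ∘ₗ loc) Z ∧
          iwasawaToPowerSeries 2 G = PowerSeries.C (ϖ : ℚ_[2]) * iwasawaToPowerSeries 2 Lf ∧
          (∀ 𝔭 : PrimeSpectrum (IwasawaAlgebra 2), 𝔭.asIdeal.height = 1 →
            PowerSeries.C (2 : ℤ_[2]) ∉ 𝔭.asIdeal →
            Literature.NumberTheory.EllipticCurves.Module.lengthAt (IwasawaAlgebra 2) Y.X 𝔭 ≤
              Literature.NumberTheory.EllipticCurves.Module.lengthAt (IwasawaAlgebra 2) (I.H ⧸ Z) 𝔭) ∧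
          (TwoAdicSurjective W →
            ∀ 𝔭 : PrimeSpectrum (IwasawaAlgebra 2), 𝔭.asIdeal.height = 1 →
              PowerSeries.C (2 : ℤ_[2]) ∈ 𝔭.asIdeal →
              Literature.NumberTheory.EllipticCurves.Module.lengthAt (IwasawaAlgebra 2) Y.X 𝔭 ≤
                Literature.NumberTheory.EllipticCurves.Module.lengthAt (IwasawaAlgebra 2) (I.H ⧸ Z) 𝔭)) :
    ∀ [NeZero (W.conductorNorm ℤ)] (f : CuspForm (Gamma0 (W.conductorNorm ℤ)) 2),
        IsNewformOf W f → ∀ (ϖ : ℚ), (ϖ : ℝ) * W.realPeriodRat = plusPeriod f →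
      ∀ (Ls Lf : IwasawaAlgebra 2), IsSprungPair f 2 (W.frobeniusTrace 2) Ls Lf →
      ∀ (D : SharpFlatSelmerDualData W κ γ ι (W.frobeniusTrace 2) g c .flat),
        Module.IsTorsion (IwasawaAlgebra 2) D.X ∧
        ∃ g' h : IwasawaAlgebra 2, D.charIdeal = Ideal.span {g'} ∧
          iwasawaToPowerSeries 2 (g' * h) = PowerSeries.C (ϖ : ℚ_[2]) * iwasawaToPowerSeries 2 Lf := by
  intro _ f hf ϖ hϖ Ls Lf hSP D
  haveI : ContinuousSMul ℤ_[2] (W.tateModule 2) := TateModule.continuousSMul_padicInt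
  obtain ⟨I, Y, P, loc, toX, δ, Z, G, hPX, hXY, hGZ, hιG, hESrat, hES2⟩ := hCK f hf ϖ hϖ Ls Lf hSP D
  have hY : Module.IsTorsion (IwasawaAlgebra 2) Y.X := hX0 W 2 κ γ hκ hγ Y
  obtain ⟨htf, hrank⟩ := h124.isTorsionFree_and_rank_le_one W 2 hκ hγ I
  haveI := htf
  -- `G ≠ 0`: `ϖ ≠ 0` (else `Ω⁺_f = 0`, contradicting `L(E,1) = [0]⁺·Ω⁺_f ≠ 0`) and `L♭ ≠ 0`
  have hLf : Lf ≠ 0 := flat_ne_zero_two W hf hgood hss hL hSP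
  have hϖ0 : ϖ ≠ 0 := by
    intro h0
    apply hL
    rw [hf.entireLFunction_one_eq, ← hϖ, h0]
    simp
  have hG : G ≠ 0 := by
    intro h0
    rw [h0, map_zero] at hιG
    have h1 : PowerSeries.C (ϖ : ℚ_[2]) * iwasawaToPowerSeries 2 Lf ≠ 0 := by
      refine mul_ne_zero ?_ ?_
      · intro hC
        have := congrArg PowerSeries.constantCoeff hC
        simp only [PowerSeries.constantCoeff_C, map_zero] at this
        exact hϖ0 (by exact_mod_cast this)
      · intro hz
        exact hLf ((iwasawaToPowerSeries_injective 2) (by rw [hz, map_zero]))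
    exact h1 hιG.symm
  have hES : ∀ 𝔭 : PrimeSpectrum (IwasawaAlgebra 2), 𝔭.asIdeal.height = 1 →
      Literature.NumberTheory.EllipticCurves.Module.lengthAt (IwasawaAlgebra 2) Y.X 𝔭 ≤
        Literature.NumberTheory.EllipticCurves.Module.lengthAt (IwasawaAlgebra 2) (I.H ⧸ Z) 𝔭 := by
    intro 𝔭 h1
    by_cases h2 : PowerSeries.C (2 : ℤ_[2]) ∈ 𝔭.asIdeal
    · exact hES2 hsurj 𝔭 h1 h2
    · exact hESrat 𝔭 h1 h2
  refine ⟨sharpFlatSelmerDual_isTorsion_of_colemanSkeleton I hrank Y D loc P.subtype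
      P.injective_subtype toX δ hPX hXY hY Z hG hGZ, ?_⟩
  obtain ⟨g', h, hg, hgh⟩ := exists_charGenerator_mul_eq_of_colemanSkeleton' hγ I hrank Y D loc
    P.subtype P.injective_subtype toX δ hPX hXY hY Z hGZ hES
  exact ⟨g', h, hg, by rw [hgh]; exact hιG⟩

/-- **The ♭ upper divisibility at the curve WITHOUT the image certificate, from the package's RATIONAL
part and `μ(X^♭) = 0`.** For the supplied data: Kato's facts + the ♭ package (only F1♭ · F3♭ · F4rat are
used) + `μ(X^♭(E/ℚ_∞)) = 0` (`2 ∤` a characteristic power series) ⇒ `X^♭` torsion, `char X^♭ = (g')`,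
`ι(g'·h) = ϖ·ι L♭`. The `2`-adic image hypothesis (12.5.2) enters the ♭ road EXACTLY through the `μ`-part,
as on the `±` road (`SSColemanRoad.dvd_of_dvd_C_pow_mul_of_not_dvd`).
[cite: Sprung2012, Thm. 7.16 first clause (p. 1504)] [cite: Kato2004Asterisque, Thm. 12.5 (3) (p. 222)] -/
theorem flatUpper_two_of_flatColemanKato_of_mu (h124 : Kato2004.thm12_4)
    (hX0 : Kato2004_fineSelmerDual_isTorsion)
    (hgood : W.HasGoodReductionAtPrime 2) (hss : (2 : ℤ) ∣ W.frobeniusTrace 2)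
    (hL : W.entireLFunction 1 ≠ 0)
    (hκ : κ.IsCyclotomic) (hγ : κ.IsTopGenerator γ)
    (hCK : ∀ [NeZero (W.conductorNorm ℤ)] (f : CuspForm (Gamma0 (W.conductorNorm ℤ)) 2),
        IsNewformOf W f → ∀ (ϖ : ℚ), (ϖ : ℝ) * W.realPeriodRat = plusPeriod f →
      ∀ (Ls Lf : IwasawaAlgebra 2), IsSprungPair f 2 (W.frobeniusTrace 2) Ls Lf →
      ∀ (D : SharpFlatSelmerDualData W κ γ ι (W.frobeniusTrace 2) g c .flat)
        [ContinuousSMul ℤ_[2] (W.tateModule 2)],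
        ∃ (I : Kato2004.IwasawaH1Data W 2 κ γ) (Y : W.FineSelmerDualData κ γ)
          (P : Submodule (IwasawaAlgebra 2) (IwasawaAlgebra 2))
          (loc : I.H →ₗ[IwasawaAlgebra 2] P) (toX : P →ₗ[IwasawaAlgebra 2] D.X)
          (δ : D.X →ₗ[IwasawaAlgebra 2] Y.X) (Z : Submodule (IwasawaAlgebra 2) I.H)
          (G : IwasawaAlgebra 2),
          Function.Exact loc toX ∧ Function.Exact toX δ ∧
          G ∈ Submodule.map (P.subtype ∘ₗ loc) Z ∧
          iwasawaToPowerSeries 2 G = PowerSeries.C (ϖ : ℚ_[2]) * iwasawaToPowerSeries 2 Lf ∧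
          (∀ 𝔭 : PrimeSpectrum (IwasawaAlgebra 2), 𝔭.asIdeal.height = 1 →
            PowerSeries.C (2 : ℤ_[2]) ∉ 𝔭.asIdeal →
            Literature.NumberTheory.EllipticCurves.Module.lengthAt (IwasawaAlgebra 2) Y.X 𝔭 ≤
              Literature.NumberTheory.EllipticCurves.Module.lengthAt (IwasawaAlgebra 2) (I.H ⧸ Z) 𝔭) ∧
          (TwoAdicSurjective W →
            ∀ 𝔭 : PrimeSpectrum (IwasawaAlgebra 2), 𝔭.asIdeal.height = 1 →
              PowerSeries.C (2 : ℤ_[2]) ∈ 𝔭.asIdeal →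
              Literature.NumberTheory.EllipticCurves.Module.lengthAt (IwasawaAlgebra 2) Y.X 𝔭 ≤
                Literature.NumberTheory.EllipticCurves.Module.lengthAt (IwasawaAlgebra 2) (I.H ⧸ Z) 𝔭))
    (hμ : ∀ (D : SharpFlatSelmerDualData W κ γ ι (W.frobeniusTrace 2) g c .flat) (g' : IwasawaAlgebra 2),
        D.charIdeal = Ideal.span {g'} → ¬ PowerSeries.C (2 : ℤ_[2]) ∣ g') :
    ∀ [NeZero (W.conductorNorm ℤ)] (f : CuspForm (Gamma0 (W.conductorNorm ℤ)) 2),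
        IsNewformOf W f → ∀ (ϖ : ℚ), (ϖ : ℝ) * W.realPeriodRat = plusPeriod f →
      ∀ (Ls Lf : IwasawaAlgebra 2), IsSprungPair f 2 (W.frobeniusTrace 2) Ls Lf →
      ∀ (D : SharpFlatSelmerDualData W κ γ ι (W.frobeniusTrace 2) g c .flat),
        Module.IsTorsion (IwasawaAlgebra 2) D.X ∧
        ∃ g' h : IwasawaAlgebra 2, D.charIdeal = Ideal.span {g'} ∧
          iwasawaToPowerSeries 2 (g' * h) = PowerSeries.C (ϖ : ℚ_[2]) * iwasawaToPowerSeries 2 Lf := by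
  intro _ f hf ϖ hϖ Ls Lf hSP D
  haveI : ContinuousSMul ℤ_[2] (W.tateModule 2) := TateModule.continuousSMul_padicInt
  obtain ⟨I, Y, P, loc, toX, δ, Z, G, hPX, hXY, hGZ, hιG, hESrat, -⟩ := hCK f hf ϖ hϖ Ls Lf hSP D
  have hY : Module.IsTorsion (IwasawaAlgebra 2) Y.X := hX0 W 2 κ γ hκ hγ Y
  obtain ⟨htf, hrank⟩ := h124.isTorsionFree_and_rank_le_one W 2 hκ hγ I
  haveI := htf
  have hLf : Lf ≠ 0 := flat_ne_zero_two W hf hgood hss hL hSP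
  have hϖ0 : ϖ ≠ 0 := by
    intro h0
    apply hL
    rw [hf.entireLFunction_one_eq, ← hϖ, h0]
    simp
  have hG : G ≠ 0 := by
    intro h0
    rw [h0, map_zero] at hιG
    have h1 : PowerSeries.C (ϖ : ℚ_[2]) * iwasawaToPowerSeries 2 Lf ≠ 0 := by
      refine mul_ne_zero ?_ ?_
      · intro hC
        have := congrArg PowerSeries.constantCoeff hC
        simp only [PowerSeries.constantCoeff_C, map_zero] at this
        exact hϖ0 (by exact_mod_cast this)
      · intro hz
        exact hLf ((iwasawaToPowerSeries_injective 2) (by rw [hz, map_zero]))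
    exact h1 hιG.symm
  obtain ⟨htors, m, hm⟩ := exists_pow_mul_mem_charIdeal_of_colemanSkeletonRat' hγ I hrank Y D loc
    P.subtype P.injective_subtype toX δ hPX hXY hY Z hG hGZ
    (fun 𝔭 h1 hp𝔭 ↦ hESrat 𝔭 h1 (by simpa using hp𝔭))
  refine ⟨htors, ?_⟩
  obtain ⟨g', hg⟩ := (charIdeal_isPrincipal_holds 2 D.X).principal
  have hg' : D.charIdeal = Ideal.span {g'} := hg
  have h2C : (PowerSeries.C ((2 : ℕ) : ℤ_[2]) : IwasawaAlgebra 2) = PowerSeries.C (2 : ℤ_[2]) := by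
    simp
  rw [h2C, hg'] at hm
  have hdvd : g' ∣ PowerSeries.C (2 : ℤ_[2]) ^ m * G := Ideal.mem_span_singleton.mp hm
  have h2 : Prime (PowerSeries.C (2 : ℤ_[2]) : IwasawaAlgebra 2) := by
    rw [← h2C]; exact IwasawaAlgebra.prime_C 2
  obtain ⟨h, hh⟩ := SSColemanRoad.dvd_of_dvd_C_pow_mul_of_not_dvd h2 (hμ D g' hg') hdvd
  exact ⟨g', h, hg', by rw [← hh]; exact hιG⟩

end AtTwo

end SSFlatRoad
end Summit.BirchSwinnertonDyer.BirchSwinnertonDyer.Theorems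

end
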